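import Summits.HodgeConjecture.HodgeConjecture.Theorems.F0P6aStubRHO1K4Seam
import HarnessLib

/-!
# `F0P6aStubRHO1KillRow` — ★ RE-HOME of `Lines/F0_P6a_StubRHO1.lean` (tree sha16 ce86702e556aed39, 1561 l.), PART 2 of 6 — tree lines :334–:600
See PART 1 `Theorems/F0P6aStubRHO1K4Seam.lean` for the full ★ re-home header and the original module docstring (verbatim there).  Same namespace (every
fully-qualified name unchanged); the scopes open at the cut are re-opened below with their `variable` ∕ `open` ∕ `set_option` ∕ `universe` lines replayed verbatim
from the tree, in order; the code after the replay block is the tree bytes :334–:600, untouched except the (d1) cure named in PART 1.  HC_CM is proved only modulo the 7 printed citations (2 remaining: hLiu418 = stmt-HodgeConjecture-24832, h413 = stmt-HodgeConjecture-24833) until rung 0 closes; a re-home is count-neutral.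
-/

-- ── replay of the scopes open at tree line :334 (verbatim) ──
set_option autoImplicit false
set_option linter.dupNamespace false
noncomputable section
namespace Summit.HodgeConjecture.HodgeConjecture.Cruxes.HLiu418.F0P6aLineSpecialisation
open CategoryTheory CategoryTheory.Limits NumberField IsDedekindDomain MulAction AlgebraicGeometry
open scoped Matrix Polynomial Pointwise MonoidalCategory
open Literature.NumberTheory.GaloisRepresentations
open Literature.NumberTheory.Automorphic Literature.NumberTheory.Automorphic.UnitaryGroup
open Literature.AlgebraicGeometry.ShimuraVarieties.UnitaryCanonicalModel
open Literature.NumberTheory.Automorphic.Liu2021.AppendixC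
open Literature.AlgebraicGeometry.Motives (AlgPoints IntegralModel SchemeOver thickening thickeningGalAction thickeningLift specOver extendPoint
  specValuationSubring specFractionFieldι specRingHomι)
open Literature.NumberTheory.EllipticCurves (genericFibre specGenericPoint)
open Literature.NumberTheory.DiophantineGeometry (geomResidueField specialFibreFunctor specResidueField geomClosedPointIsoSpecResidueField
  toClosureValuationSubring)
open Literature.AlgebraicGeometry.RelativeSpec (ActionOver)
open Literature.AlgebraicGeometry.AbelianSchemes Literature.AlgebraicGeometry.AbelianSchemes.AbelianSchemeOver
open Literature.AlgebraicGeometry.GroupSchemes.AffineGroupScheme (Alg quotIncl)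
open Summit.HodgeConjecture.HodgeConjecture.Cruxes.HLiu418.F0P6aModuliDatumDefs
open Summit.HodgeConjecture.HodgeConjecture.Cruxes.HLiu418.F0P6aRGDAssembly
open Summit.HodgeConjecture.HodgeConjecture.Cruxes.HLiu418.F0P6aDatumOfInputs
section QuotLegReduction
open scoped MonObj CategoryTheory.Obj
variable {F : Type} [Field F] [NumberField F] [IsCMField F] {ι₁ : F →+* ℂ}
    {Jstar : Matrix (Fin 2) (Fin 2) F}
    {K₀ : C5.OpenCompactSubgroup ↥(finAdelic ↥(maximalRealSubfield F) F (IsCMField.complexConj F) 2 Jstar)}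
    {S : RecordSystemGS F Jstar ι₁ K₀} {hU7ₛ : S.HeckeTranslateDefinedOver}
    {hJ : (Jstar.map (IsCMField.complexConj F))ᵀ = Jstar} {hJu : IsUnit Jstar}
    {Fi : Type} [Field Fi] [Algebra F Fi] {Kc : C5.SmallLevel K₀} {G : Type} [Group G]
    {𝓜 : IntegralModel (𝓞 F) F ((thickening F Fi).obj (S.M.obj Kc))}
    {w : HeightOneSpectrum (𝓞 F)} {hw : (IsCMField.complexConj F) • w ≠ w} {h𝓨 : (𝓜.localise w).IsSmoothProper 1}
    {θ : ActionOver (𝓜.localise w).total.hom ((Fi ≃ₐ[F] Fi) × G)}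
    {e : Fi →ₐ[F] AlgebraicClosure (w.adicCompletion F)}
set_option backward.isDefEq.respectTransparency false
section KillRow
open scoped MonObj CategoryTheory.Obj

set_option maxHeartbeats 400000 in
/-- **(KILL) row of (ρ1𝒞)** — `q̄` kills `V(spGeoOf y L) ↪ G₀(x̄) ↪ A_{x̄}`: served (KE) HEAD-K `quotIncl_spGeoOf_comp_eq_one_of_kerRow` with its (F1) binders paid by the
LS ED. 3 pins `isoGenericOf_inv`∕`isoSpecialOf_inv`; hypotheses = the legs' `hKL`, (r1) and the reduced leg's (K3₀) row in ★ p850352 text; conclusion = the (KILL) conjunct of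
`stub_RHO1` VERBATIM (`ψ := q̄` at the heads' type). [cite: Liu2021, Prop. D.8 (3) p. 135, pp. 136–138] [cite: SerreTate1968, §1 Lemma 2] -/
theorem kill_row_of_kerRow_sigma (I : RGDInputsAt F ι₁ Jstar K₀ S hU7ₛ hJ hJu Fi Kc G 𝓜 w hw h𝓨 θ e) [ExpChar (geomResidueField w) I.pChar]
    (𝔡 : ∀ xbar, DockAt I xbar)
    {m : ℕ} (E' : Matrix (Fin m) (Fin m) (𝓞 F)) (hE' : E' * E' = E')
    (y y'' : AlgPoints (S.M.obj Kc) (AlgebraicClosure (w.adicCompletion F)))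
    (L : LineOf I y)
    {B : AbelianSchemeOver (Spec (CommRingCat.of (AlgebraicClosure (w.adicCompletion F))))}
    (q : (schΩOf S Kc 𝓜 w e I.univ y).X ⟶ B.X)
    [IsMonHom q]
    (K : Subgroup ((fibreΩOf S Kc 𝓜 w e I.univ y).Points (AlgebraicClosure (w.adicCompletion F))))
    (hKL : ∀ P, P ∈ L.1 ↔ P ∈ K ∧ IsIdealTorsionΩ S Kc 𝓜 w e I.univ I.act y ((IsCMField.complexConj F) • w).asIdeal P)
    (r1 : ∀ P : (fibreΩOf S Kc 𝓜 w e I.univ y).Points (AlgebraicClosure (w.adicCompletion F)),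
      (AlgPoints.map q P : B.toAffine.toAbelianVariety.Points (AlgebraicClosure (w.adicCompletion F))) = 1 ↔ P ∈ K)
    -- `q̄` in ★'s ∕ W1-a's spelling
    (qbar : haveI := I.comm
      haveI : IsProper (𝓜.localise w).total.hom := h𝓨.2
      ((I.univ.baseChange (pullback.fst (𝓜.localise w).total.hom (specResidueField w))).baseChange ((𝓜.localise w).geomReductionMap (thickeningLift e (S.M.obj Kc) y)).left).X ⟶
        (((serreTensor I.act E' hE').baseChange (pullback.fst (𝓜.localise w).total.hom (specResidueField w))).baseChange ((𝓜.localise w).geomReductionMap (thickeningLift e (S.M.obj Kc) y'')).left).X)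
    (hσΩ : (isoGenericOf I y).inv =
      (I.univ.fibreBaseChangeIso ((𝓜.localise w).genericIso'.inv.left ≫ pullback.fst (𝓜.localise w).total.hom (specGenericPoint (HeightOneSpectrum.valuationSubringAtPrime F w) F))
          (thickeningLift e (S.M.obj Kc) y).left ≪≫
        I.univ.fibreCongrPtIso (left_thickeningLift_comp_genericι_eq S Kc 𝓜 w h𝓨 e y) ≪≫
        (I.univ.fibreBaseChangeIso (liftOf S Kc 𝓜 w h𝓨 e y).left (sΩ w)).symm).inv.hom.hom.hom)
    (hσκ : (isoSpecialOf I y).inv =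
      (I.univ.fibreBaseChangeIso (pullback.fst (𝓜.localise w).total.hom (specResidueField w)) (red₀Of S Kc 𝓜 w h𝓨 e y).left ≪≫
        I.univ.fibreCongrPtIso (left_red₀Of_comp_specialι_eq S Kc 𝓜 w h𝓨 e y) ≪≫
        (I.univ.fibreBaseChangeIso (liftOf S Kc 𝓜 w h𝓨 e y).left (sκ w)).symm).inv.hom.hom.hom)
    -- the (K3-gen) row in ★'s ∕ (b′)'s text
    (hK3₀ : haveI := I.comm
      haveI : IsProper (𝓜.localise w).total.hom := h𝓨.2
      ∀ (𝒦 : Over (Spec (.of (closureValuationSubring (w.adicCompletion F))))) (incl : 𝒦 ⟶ (I.univ.baseChange (extendPoint (closureValuationSubring (w.adicCompletion F)) (toClosureValuationSubring w) (𝓜.localise w).total ((𝓜.localise w).modelPointsEquiv.symm (thickeningLift e (S.M.obj Kc) y))).left).X) [Flat 𝒦.hom],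
        ((Over.pullback (specFractionFieldι (closureValuationSubring (w.adicCompletion F)) (toClosureValuationSubring w)).left).map incl ≫
            (I.univ.fibreBaseChangeIso ((𝓜.localise w).genericIso'.inv.left ≫ pullback.fst (𝓜.localise w).total.hom (specGenericPoint (HeightOneSpectrum.valuationSubringAtPrime F w) F)) (thickeningLift e (S.M.obj Kc) y).left ≪≫ I.univ.fibreCongrPtIso ((𝓜.localise w).left_specFractionFieldι_comp_extendPoint_modelPointsEquiv_symm (thickeningLift e (S.M.obj Kc) y)).symm ≪≫ (I.univ.fibreBaseChangeIso (extendPoint (closureValuationSubring (w.adicCompletion F)) (toClosureValuationSubring w) (𝓜.localise w).total ((𝓜.localise w).modelPointsEquiv.symm (thickeningLift e (S.M.obj Kc) y))).left (specFractionFieldι (closureValuationSubring (w.adicCompletion F)) (toClosureValuationSubring w)).left).symm).inv.hom.hom.hom) ≫ q = 1 →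
        ((Over.pullback ((geomClosedPointIsoSpecResidueField w).inv.left ≫ (specRingHomι (closureValuationSubring (w.adicCompletion F)) (toClosureValuationSubring w) (IsLocalRing.residue (closureValuationSubring (w.adicCompletion F)))).left)).map incl ≫
            (I.univ.fibreBaseChangeIso (pullback.fst (𝓜.localise w).total.hom (specResidueField w)) ((𝓜.localise w).geomReductionMap (thickeningLift e (S.M.obj Kc) y)).left ≪≫ I.univ.fibreCongrPtIso (((𝓜.localise w).left_geomReductionMap_comp_fst (thickeningLift e (S.M.obj Kc) y)).trans (Category.assoc _ _ _).symm) ≪≫ (I.univ.fibreBaseChangeIso (extendPoint (closureValuationSubring (w.adicCompletion F)) (toClosureValuationSubring w) (𝓜.localise w).total ((𝓜.localise w).modelPointsEquiv.symm (thickeningLift e (S.M.obj Kc) y))).left ((geomClosedPointIsoSpecResidueField w).inv.left ≫ (specRingHomι (closureValuationSubring (w.adicCompletion F)) (toClosureValuationSubring w) (IsLocalRing.residue (closureValuationSubring (w.adicCompletion F)))).left)).symm).inv.hom.hom.hom) ≫ qbar = 1) :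
    haveI := I.comm
    letI := (𝔡 (red₀Of S Kc 𝓜 w h𝓨 e y)).grp₀
    haveI := (𝔡 (red₀Of S Kc 𝓜 w h𝓨 e y)).aff₀
    quotIncl (𝔡 (red₀Of S Kc 𝓜 w h𝓨 e y)).G₀ (spGeoOf I 𝔡 y L).1 ≫ (𝔡 (red₀Of S Kc 𝓜 w h𝓨 e y)).ι₀G ≫
        (qbar : (sch₀Of 𝓜 w I.univ (red₀Of S Kc 𝓜 w h𝓨 e y)).X ⟶ (sch₀Of 𝓜 w (serreTensor I.act E' hE') (red₀Of S Kc 𝓜 w h𝓨 e y'')).X) = 1 := by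
  haveI := I.comm
  exact quotIncl_spGeoOf_comp_eq_one_of_kerRow I 𝔡 y L q K hKL r1
    (qbar : (sch₀Of 𝓜 w I.univ (red₀Of S Kc 𝓜 w h𝓨 e y)).X ⟶ (sch₀Of 𝓜 w (serreTensor I.act E' hE') (red₀Of S Kc 𝓜 w h𝓨 e y'')).X)
    hσΩ hσκ hK3₀

end KillRow

section DockRow

open scoped MonObj CategoryTheory.Obj
open Literature.AlgebraicGeometry.GroupSchemes (GroupSchemeKernel.ker)
open Summit.HodgeConjecture.HodgeConjecture.Cruxes.HLiu418.F0P6aRoofWCounts (comp_ι₀G_comp_eq_one_iff_of_kill_sch₀Of)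

/-! #### SEALED-DOCK chain (LA1-p02 (g4), LA1-plan (g5) «GO sealed-DOCK» 2026-09-02T14:30:22Z)
W7 §7 must be handed a leg typed AT THE SOCKET CARRIER on both sides (`(sch₀Of … (red₀Of … y)).X ⟶ (sch₀Of … (serreTensor …) (red₀Of … y″)).X`):
then its call is syntactic (49 828 kHB measured); with ★'s raw carrier anywhere in the leg's type the implicit `Bbar : AbelianSchemeOver (Spec (.of κ̄))`
meets a base `(specOver κ̄ κ̄).left` and the call costs 389 480 (v5) or times out (400 019, raw target).  The rows, however, are produced at ★'s raw
carrier (④ ∕ §K4 ∕ (KE) ∕ (KEW)).  So the carrier change is performed ONCE PER ROW GROUP in two SEALED converters (`∀ ψ : socket carrier, qbar = ψ → …`,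
proof `subst`), the §7 call is made on the sealed leg, and `dock_row_of_kerRow_unseal` returns to the raw spelling that `dock_row_of_legs_sigma` states. -/

set_option maxHeartbeats 400000 in
/-- **SEAL ① (leg rows)** — `IsMonHom`, (r4) `hr4`, (FIN) `hfin`, (RK) `hrkK` of the reduced leg, re-typed at the socket carrier: for every `ψ` at the socket
carrier equal to `q̄`, the four facts hold of `ψ` in W7 §7's spelling.  Inputs = the §K4 one-liners' outputs VERBATIM. [cite: Liu2021, Prop. D.8 (3) p. 135, pp. 136–138] [cite: Tate1997FiniteFlatGroupSchemes, §(3.7) (p. 146)] [cite: GortzWedhorn2020, Definition 4.45 (2) (p. 117)] -/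
theorem dockSeal₁ [IsGalois ℚ F] (I : RGDInputsAt F ι₁ Jstar K₀ S hU7ₛ hJ hJu Fi Kc G 𝓜 w hw h𝓨 θ e)
    {m : ℕ} (E' : Matrix (Fin m) (Fin m) (𝓞 F)) (hE' : E' * E' = E')
    (y y'' : AlgPoints (S.M.obj Kc) (AlgebraicClosure (w.adicCompletion F)))
    (qbar : haveI := I.comm
      haveI : IsProper (𝓜.localise w).total.hom := h𝓨.2
      ((I.univ.baseChange (pullback.fst (𝓜.localise w).total.hom (specResidueField w))).baseChange ((𝓜.localise w).geomReductionMap (thickeningLift e (S.M.obj Kc) y)).left).X ⟶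
        (((serreTensor I.act E' hE').baseChange (pullback.fst (𝓜.localise w).total.hom (specResidueField w))).baseChange ((𝓜.localise w).geomReductionMap (thickeningLift e (S.M.obj Kc) y'')).left).X)
    (hqbar : haveI := I.comm
      IsMonHom (qbar : (sch₀Of 𝓜 w I.univ (red₀Of S Kc 𝓜 w h𝓨 e y)).X ⟶ (sch₀Of 𝓜 w (serreTensor I.act E' hE') (red₀Of S Kc 𝓜 w h𝓨 e y'')).X))
    (hr4 : haveI := I.comm
      ∀ a : 𝓞 F, ∃ b : (sch₀Of 𝓜 w (serreTensor I.act E' hE') (red₀Of S Kc 𝓜 w h𝓨 e y'')).X ⟶ (sch₀Of 𝓜 w (serreTensor I.act E' hE') (red₀Of S Kc 𝓜 w h𝓨 e y'')).X,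
      (act₀Of 𝓜 w I.univ I.act a (red₀Of S Kc 𝓜 w h𝓨 e y)).hom.hom.hom ≫
        (qbar : (sch₀Of 𝓜 w I.univ (red₀Of S Kc 𝓜 w h𝓨 e y)).X ⟶ (sch₀Of 𝓜 w (serreTensor I.act E' hE') (red₀Of S Kc 𝓜 w h𝓨 e y'')).X) = qbar ≫ b)
    (hfin : IsFinite qbar.left)
    (hrkK : haveI := I.comm
      Module.finrank (geomResidueField w)
        (Alg (GroupSchemeKernel.ker (qbar : (sch₀Of 𝓜 w I.univ (red₀Of S Kc 𝓜 w h𝓨 e y)).X ⟶ (sch₀Of 𝓜 w (serreTensor I.act E' hE') (red₀Of S Kc 𝓜 w h𝓨 e y'')).X))) =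
        I.pChar ^ I.fDeg * I.pChar ^ I.fDeg) :
    haveI := I.comm
    ∀ ψ : (sch₀Of 𝓜 w I.univ (red₀Of S Kc 𝓜 w h𝓨 e y)).X ⟶ (sch₀Of 𝓜 w (serreTensor I.act E' hE') (red₀Of S Kc 𝓜 w h𝓨 e y'')).X, qbar = ψ →
      IsMonHom ψ ∧
      (∀ a : 𝓞 F, ∃ b : (sch₀Of 𝓜 w (serreTensor I.act E' hE') (red₀Of S Kc 𝓜 w h𝓨 e y'')).X ⟶ (sch₀Of 𝓜 w (serreTensor I.act E' hE') (red₀Of S Kc 𝓜 w h𝓨 e y'')).X,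
      (act₀Of 𝓜 w I.univ I.act a (red₀Of S Kc 𝓜 w h𝓨 e y)).hom.hom.hom ≫
        ψ = ψ ≫ b) ∧
      IsFinite ψ.left ∧
      (Module.finrank (geomResidueField w)
        (Alg (GroupSchemeKernel.ker ψ)) =
        I.pChar ^ I.fDeg * I.pChar ^ I.fDeg) := by
  intro ψ h
  subst h
  exact ⟨hqbar, hr4, hfin, hrkK⟩

set_option maxHeartbeats 400000 in
/-- **SEAL ② (kernel bound)** — (K2) `hkerq` of the reduced leg re-typed at the socket carrier: for every `ψ` at the socket carrier equal to `q̄`, W7 §7's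
`hkerq` binder holds of `ψ`.  Input = `hkerq_of_kerRow`'s output VERBATIM; proof `subst`. [cite: Liu2021, Prop. D.8 (3) p. 135, pp. 136–138] [cite: Tate1997FiniteFlatGroupSchemes, §(3.7) (p. 146)] [cite: GortzWedhorn2020, Definition 4.45 (2) (p. 117)] -/
theorem dockSeal₂ [IsGalois ℚ F] (I : RGDInputsAt F ι₁ Jstar K₀ S hU7ₛ hJ hJu Fi Kc G 𝓜 w hw h𝓨 θ e)
    {m : ℕ} (E' : Matrix (Fin m) (Fin m) (𝓞 F)) (hE' : E' * E' = E')
    (y y'' : AlgPoints (S.M.obj Kc) (AlgebraicClosure (w.adicCompletion F)))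
    (qbar : haveI := I.comm
      haveI : IsProper (𝓜.localise w).total.hom := h𝓨.2
      ((I.univ.baseChange (pullback.fst (𝓜.localise w).total.hom (specResidueField w))).baseChange ((𝓜.localise w).geomReductionMap (thickeningLift e (S.M.obj Kc) y)).left).X ⟶
        (((serreTensor I.act E' hE').baseChange (pullback.fst (𝓜.localise w).total.hom (specResidueField w))).baseChange ((𝓜.localise w).geomReductionMap (thickeningLift e (S.M.obj Kc) y'')).left).X)
    (hkerq : haveI := I.comm
      ∀ ⦃T : SchemeOver (geomResidueField w)⦄ (z : T ⟶ (sch₀Of 𝓜 w I.univ (red₀Of S Kc 𝓜 w h𝓨 e y)).X),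
      z ≫ (qbar : (sch₀Of 𝓜 w I.univ (red₀Of S Kc 𝓜 w h𝓨 e y)).X ⟶ (sch₀Of 𝓜 w (serreTensor I.act E' hE') (red₀Of S Kc 𝓜 w h𝓨 e y'')).X) = 1 →
        ∀ b ∈ w.asIdeal * ((IsCMField.complexConj F) • w).asIdeal, z ≫ (act₀Of 𝓜 w I.univ I.act b (red₀Of S Kc 𝓜 w h𝓨 e y)).hom.hom.hom = 1) :
    haveI := I.comm
    ∀ ψ : (sch₀Of 𝓜 w I.univ (red₀Of S Kc 𝓜 w h𝓨 e y)).X ⟶ (sch₀Of 𝓜 w (serreTensor I.act E' hE') (red₀Of S Kc 𝓜 w h𝓨 e y'')).X, qbar = ψ →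
      ∀ ⦃T : SchemeOver (geomResidueField w)⦄ (z : T ⟶ (sch₀Of 𝓜 w I.univ (red₀Of S Kc 𝓜 w h𝓨 e y)).X),
      z ≫ ψ = 1 →
        ∀ b ∈ w.asIdeal * ((IsCMField.complexConj F) • w).asIdeal, z ≫ (act₀Of 𝓜 w I.univ I.act b (red₀Of S Kc 𝓜 w h𝓨 e y)).hom.hom.hom = 1 := by
  intro ψ h
  subst h
  exact hkerq

set_option maxHeartbeats 400000 in
/-- **SEAL ③ (kill + w-witness)** — (KILL) `hkill` and (CL-w) `hclw` of the reduced leg re-typed at the socket carrier: for every `ψ` at the socket carrier equal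
to `q̄`, W7 §7's `hkill` (at `H := spGeoOf I 𝔡 y L`) and `hclw` binders hold of `ψ`.  Inputs = `kill_row_of_kerRow_sigma` ∕ (KEW) `exists_wWitness_of_kerRow`
outputs VERBATIM; proof `subst`. [cite: Liu2021, Prop. D.8 (3) p. 135, pp. 136–138] [cite: Tate1997FiniteFlatGroupSchemes, §(3.7) (p. 146)] [cite: GortzWedhorn2020, Definition 4.45 (2) (p. 117)] [cite: SerreTate1968, §1 Lemma 2] -/
theorem dockSeal₃ [IsGalois ℚ F] (I : RGDInputsAt F ι₁ Jstar K₀ S hU7ₛ hJ hJu Fi Kc G 𝓜 w hw h𝓨 θ e) [ExpChar (geomResidueField w) I.pChar]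
    (𝔡 : ∀ xbar, DockAt I xbar)
    {m : ℕ} (E' : Matrix (Fin m) (Fin m) (𝓞 F)) (hE' : E' * E' = E')
    (y y'' : AlgPoints (S.M.obj Kc) (AlgebraicClosure (w.adicCompletion F))) (L : LineOf I y)
    (qbar : haveI := I.comm
      haveI : IsProper (𝓜.localise w).total.hom := h𝓨.2
      ((I.univ.baseChange (pullback.fst (𝓜.localise w).total.hom (specResidueField w))).baseChange ((𝓜.localise w).geomReductionMap (thickeningLift e (S.M.obj Kc) y)).left).X ⟶
        (((serreTensor I.act E' hE').baseChange (pullback.fst (𝓜.localise w).total.hom (specResidueField w))).baseChange ((𝓜.localise w).geomReductionMap (thickeningLift e (S.M.obj Kc) y'')).left).X)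
    (hkill : haveI := I.comm
      haveI := (𝔡 (red₀Of S Kc 𝓜 w h𝓨 e y)).aff₀
      quotIncl (𝔡 (red₀Of S Kc 𝓜 w h𝓨 e y)).G₀ (spGeoOf I 𝔡 y L).1 ≫ (𝔡 (red₀Of S Kc 𝓜 w h𝓨 e y)).ι₀G ≫
        (qbar : (sch₀Of 𝓜 w I.univ (red₀Of S Kc 𝓜 w h𝓨 e y)).X ⟶ (sch₀Of 𝓜 w (serreTensor I.act E' hE') (red₀Of S Kc 𝓜 w h𝓨 e y'')).X) = 1)
    (hclw : haveI := I.comm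
      ∃ (V : SchemeOver (geomResidueField w)) (ν : V ⟶ (sch₀Of 𝓜 w I.univ (red₀Of S Kc 𝓜 w h𝓨 e y)).X), IsClosedImmersion ν.left ∧
      (∀ ⦃T : SchemeOver (geomResidueField w)⦄ (t : T ⟶ (sch₀Of 𝓜 w I.univ (red₀Of S Kc 𝓜 w h𝓨 e y)).X), (∃ s : T ⟶ V, s ≫ ν = t) →
        (∀ r ∈ w.asIdeal, t ≫ (act₀Of 𝓜 w I.univ I.act r (red₀Of S Kc 𝓜 w h𝓨 e y)).hom.hom.hom = 1) ∧
          t ≫ (qbar : (sch₀Of 𝓜 w I.univ (red₀Of S Kc 𝓜 w h𝓨 e y)).X ⟶ (sch₀Of 𝓜 w (serreTensor I.act E' hE') (red₀Of S Kc 𝓜 w h𝓨 e y'')).X) = 1) ∧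
      I.pChar ^ I.fDeg ≤ Module.finrank (geomResidueField w) (Alg V)) :
    haveI := I.comm
    haveI := (𝔡 (red₀Of S Kc 𝓜 w h𝓨 e y)).aff₀
    ∀ ψ : (sch₀Of 𝓜 w I.univ (red₀Of S Kc 𝓜 w h𝓨 e y)).X ⟶ (sch₀Of 𝓜 w (serreTensor I.act E' hE') (red₀Of S Kc 𝓜 w h𝓨 e y'')).X, qbar = ψ →
      (quotIncl (𝔡 (red₀Of S Kc 𝓜 w h𝓨 e y)).G₀ (spGeoOf I 𝔡 y L).1 ≫ (𝔡 (red₀Of S Kc 𝓜 w h𝓨 e y)).ι₀G ≫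
        ψ = 1) ∧
      (∃ (V : SchemeOver (geomResidueField w)) (ν : V ⟶ (sch₀Of 𝓜 w I.univ (red₀Of S Kc 𝓜 w h𝓨 e y)).X), IsClosedImmersion ν.left ∧
      (∀ ⦃T : SchemeOver (geomResidueField w)⦄ (t : T ⟶ (sch₀Of 𝓜 w I.univ (red₀Of S Kc 𝓜 w h𝓨 e y)).X), (∃ s : T ⟶ V, s ≫ ν = t) →
        (∀ r ∈ w.asIdeal, t ≫ (act₀Of 𝓜 w I.univ I.act r (red₀Of S Kc 𝓜 w h𝓨 e y)).hom.hom.hom = 1) ∧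
          t ≫ ψ = 1) ∧
      I.pChar ^ I.fDeg ≤ Module.finrank (geomResidueField w) (Alg V)) := by
  intro ψ h
  subst h
  exact ⟨hkill, hclw⟩

set_option maxHeartbeats 400000 in
/-- (SEALED-DOCK, LA1-p02 (g4): the leg `qbar` is BOUND AT THE SOCKET CARRIER on both sides — W7 §7's own typing, its implicit `Bbar := sch₀Of … (red₀Of … y″)` syntactically; measured 49 828 kHB) **(DOCK) ROW OF `stub_RHO1` FROM (KILL) + THE KERNEL ROWS + (CL-w)** — `Ker q̄ ∩ G₀(red₀ y) = V(spGeoOf y L)` on all `T`-points: served W7 ED. 2 §7 at `H := spGeoOf I 𝔡 y L`,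
`x̄ := red₀Of … y`; socket text be4dc9fa :1157–:1161 token for token. [cite: Tate1997FiniteFlatGroupSchemes, §(3.7) (p. 146)] [cite: GortzWedhorn2020, Definition 4.45 (2) (p. 117)]
[cite: Liu2021, Appendix D, Prop. D.8 (3) (p. 137)] -/
theorem dock_row_of_kerRow [IsGalois ℚ F] (I : RGDInputsAt F ι₁ Jstar K₀ S hU7ₛ hJ hJu Fi Kc G 𝓜 w hw h𝓨 θ e) [ExpChar (geomResidueField w) I.pChar]
    (𝔡 : ∀ xbar, DockAt I xbar)
    {m : ℕ} (E' : Matrix (Fin m) (Fin m) (𝓞 F)) (hE' : E' * E' = E')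
    (y y'' : AlgPoints (S.M.obj Kc) (AlgebraicClosure (w.adicCompletion F))) (L : LineOf I y)
    -- `q̄` in ★'s ∕ W1-a's spelling, a homomorphism AT THE HEADS' TYPE
    (qbar : haveI := I.comm
      (sch₀Of 𝓜 w I.univ (red₀Of S Kc 𝓜 w h𝓨 e y)).X ⟶ (sch₀Of 𝓜 w (serreTensor I.act E' hE') (red₀Of S Kc 𝓜 w h𝓨 e y'')).X)
    (hqbar : haveI := I.comm
      IsMonHom qbar)
    -- the four kernel rows in W7 currency (K4 one-liners)
    (hr4 : haveI := I.comm
      ∀ a : 𝓞 F, ∃ b : (sch₀Of 𝓜 w (serreTensor I.act E' hE') (red₀Of S Kc 𝓜 w h𝓨 e y'')).X ⟶ (sch₀Of 𝓜 w (serreTensor I.act E' hE') (red₀Of S Kc 𝓜 w h𝓨 e y'')).X,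
      (act₀Of 𝓜 w I.univ I.act a (red₀Of S Kc 𝓜 w h𝓨 e y)).hom.hom.hom ≫
        qbar = qbar ≫ b)
    (hkerq : haveI := I.comm
      ∀ ⦃T : SchemeOver (geomResidueField w)⦄ (z : T ⟶ (sch₀Of 𝓜 w I.univ (red₀Of S Kc 𝓜 w h𝓨 e y)).X),
      z ≫ qbar = 1 →
        ∀ b ∈ w.asIdeal * ((IsCMField.complexConj F) • w).asIdeal, z ≫ (act₀Of 𝓜 w I.univ I.act b (red₀Of S Kc 𝓜 w h𝓨 e y)).hom.hom.hom = 1)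
    (hfin : IsFinite qbar.left)
    (hrkK : haveI := I.comm
      Module.finrank (geomResidueField w)
        (Alg (GroupSchemeKernel.ker qbar)) =
        I.pChar ^ I.fDeg * I.pChar ^ I.fDeg)
    -- (KILL) in the socket's spelling
    (hkill : haveI := I.comm
      haveI := (𝔡 (red₀Of S Kc 𝓜 w h𝓨 e y)).aff₀
      quotIncl (𝔡 (red₀Of S Kc 𝓜 w h𝓨 e y)).G₀ (spGeoOf I 𝔡 y L).1 ≫ (𝔡 (red₀Of S Kc 𝓜 w h𝓨 e y)).ι₀G ≫
        qbar = 1)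
    -- (CL-w) = (KEW) HEAD-W's conclusion
    (hclw : haveI := I.comm
      ∃ (V : SchemeOver (geomResidueField w)) (ν : V ⟶ (sch₀Of 𝓜 w I.univ (red₀Of S Kc 𝓜 w h𝓨 e y)).X), IsClosedImmersion ν.left ∧
      (∀ ⦃T : SchemeOver (geomResidueField w)⦄ (t : T ⟶ (sch₀Of 𝓜 w I.univ (red₀Of S Kc 𝓜 w h𝓨 e y)).X), (∃ s : T ⟶ V, s ≫ ν = t) →
        (∀ r ∈ w.asIdeal, t ≫ (act₀Of 𝓜 w I.univ I.act r (red₀Of S Kc 𝓜 w h𝓨 e y)).hom.hom.hom = 1) ∧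
          t ≫ qbar = 1) ∧
      I.pChar ^ I.fDeg ≤ Module.finrank (geomResidueField w) (Alg V)) :
    haveI := I.comm
    letI := (𝔡 (red₀Of S Kc 𝓜 w h𝓨 e y)).grp₀
    haveI := (𝔡 (red₀Of S Kc 𝓜 w h𝓨 e y)).aff₀
    ∀ ⦃T : SchemeOver (geomResidueField w)⦄ (t : T ⟶ (𝔡 (red₀Of S Kc 𝓜 w h𝓨 e y)).G₀),
      t ≫ (𝔡 (red₀Of S Kc 𝓜 w h𝓨 e y)).ι₀G ≫
          qbar = 1 ↔
        ∃ s : T ⟶ specOver (geomResidueField w) (Alg (𝔡 (red₀Of S Kc 𝓜 w h𝓨 e y)).G₀ ⧸ (spGeoOf I 𝔡 y L).1),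
          s ≫ quotIncl (𝔡 (red₀Of S Kc 𝓜 w h𝓨 e y)).G₀ (spGeoOf I 𝔡 y L).1 = t := by
  intro T t
  haveI := I.comm
  haveI := hqbar
  exact comp_ι₀G_comp_eq_one_iff_of_kill_sch₀Of I 𝔡 (red₀Of S Kc 𝓜 w h𝓨 e y)
    qbar
    hr4 hkerq hfin hrkK (spGeoOf I 𝔡 y L) hkill hclw t

set_option maxHeartbeats 400000 in
/-- **UNSEAL = THE (DOCK) ROW AT `q̄` ITSELF** — from the three seals: under the binder `ψ` (socket carrier) W7 §7 is called SYNTACTICALLY through `dock_row_of_kerRow`,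
then `ψ := q̄, rfl`; the single carrier change of the conclusion (socket spelling ↦ the raw spelling `dock_row_of_legs_sigma` states) is paid here and only here. [cite: Liu2021, Prop. D.8 (3) p. 135, pp. 136–138] [cite: Tate1997FiniteFlatGroupSchemes, §(3.7) (p. 146)] [cite: GortzWedhorn2020, Definition 4.45 (2) (p. 117)] -/
theorem dock_row_of_kerRow_unseal [IsGalois ℚ F] (I : RGDInputsAt F ι₁ Jstar K₀ S hU7ₛ hJ hJu Fi Kc G 𝓜 w hw h𝓨 θ e) [ExpChar (geomResidueField w) I.pChar]
    (𝔡 : ∀ xbar, DockAt I xbar)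
    {m : ℕ} (E' : Matrix (Fin m) (Fin m) (𝓞 F)) (hE' : E' * E' = E')
    (y y'' : AlgPoints (S.M.obj Kc) (AlgebraicClosure (w.adicCompletion F))) (L : LineOf I y)
    (qbar : haveI := I.comm
      haveI : IsProper (𝓜.localise w).total.hom := h𝓨.2
      ((I.univ.baseChange (pullback.fst (𝓜.localise w).total.hom (specResidueField w))).baseChange ((𝓜.localise w).geomReductionMap (thickeningLift e (S.M.obj Kc) y)).left).X ⟶
        (((serreTensor I.act E' hE').baseChange (pullback.fst (𝓜.localise w).total.hom (specResidueField w))).baseChange ((𝓜.localise w).geomReductionMap (thickeningLift e (S.M.obj Kc) y'')).left).X)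
    (s₁ : haveI := I.comm
      ∀ ψ : (sch₀Of 𝓜 w I.univ (red₀Of S Kc 𝓜 w h𝓨 e y)).X ⟶ (sch₀Of 𝓜 w (serreTensor I.act E' hE') (red₀Of S Kc 𝓜 w h𝓨 e y'')).X, qbar = ψ →
        IsMonHom ψ ∧
        (∀ a : 𝓞 F, ∃ b : (sch₀Of 𝓜 w (serreTensor I.act E' hE') (red₀Of S Kc 𝓜 w h𝓨 e y'')).X ⟶ (sch₀Of 𝓜 w (serreTensor I.act E' hE') (red₀Of S Kc 𝓜 w h𝓨 e y'')).X,
        (act₀Of 𝓜 w I.univ I.act a (red₀Of S Kc 𝓜 w h𝓨 e y)).hom.hom.hom ≫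
          ψ = ψ ≫ b) ∧
        IsFinite ψ.left ∧
        (Module.finrank (geomResidueField w)
          (Alg (GroupSchemeKernel.ker ψ)) =
          I.pChar ^ I.fDeg * I.pChar ^ I.fDeg))
    (s₂ : haveI := I.comm
      ∀ ψ : (sch₀Of 𝓜 w I.univ (red₀Of S Kc 𝓜 w h𝓨 e y)).X ⟶ (sch₀Of 𝓜 w (serreTensor I.act E' hE') (red₀Of S Kc 𝓜 w h𝓨 e y'')).X, qbar = ψ →
        ∀ ⦃T : SchemeOver (geomResidueField w)⦄ (z : T ⟶ (sch₀Of 𝓜 w I.univ (red₀Of S Kc 𝓜 w h𝓨 e y)).X),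
        z ≫ ψ = 1 →
          ∀ b ∈ w.asIdeal * ((IsCMField.complexConj F) • w).asIdeal, z ≫ (act₀Of 𝓜 w I.univ I.act b (red₀Of S Kc 𝓜 w h𝓨 e y)).hom.hom.hom = 1)
    (s₃ : haveI := I.comm
      haveI := (𝔡 (red₀Of S Kc 𝓜 w h𝓨 e y)).aff₀
      ∀ ψ : (sch₀Of 𝓜 w I.univ (red₀Of S Kc 𝓜 w h𝓨 e y)).X ⟶ (sch₀Of 𝓜 w (serreTensor I.act E' hE') (red₀Of S Kc 𝓜 w h𝓨 e y'')).X, qbar = ψ →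
        (quotIncl (𝔡 (red₀Of S Kc 𝓜 w h𝓨 e y)).G₀ (spGeoOf I 𝔡 y L).1 ≫ (𝔡 (red₀Of S Kc 𝓜 w h𝓨 e y)).ι₀G ≫
          ψ = 1) ∧
        (∃ (V : SchemeOver (geomResidueField w)) (ν : V ⟶ (sch₀Of 𝓜 w I.univ (red₀Of S Kc 𝓜 w h𝓨 e y)).X), IsClosedImmersion ν.left ∧
        (∀ ⦃T : SchemeOver (geomResidueField w)⦄ (t : T ⟶ (sch₀Of 𝓜 w I.univ (red₀Of S Kc 𝓜 w h𝓨 e y)).X), (∃ s : T ⟶ V, s ≫ ν = t) →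
          (∀ r ∈ w.asIdeal, t ≫ (act₀Of 𝓜 w I.univ I.act r (red₀Of S Kc 𝓜 w h𝓨 e y)).hom.hom.hom = 1) ∧
            t ≫ ψ = 1) ∧
        I.pChar ^ I.fDeg ≤ Module.finrank (geomResidueField w) (Alg V))) :
    haveI := I.comm
    letI := (𝔡 (red₀Of S Kc 𝓜 w h𝓨 e y)).grp₀
    haveI := (𝔡 (red₀Of S Kc 𝓜 w h𝓨 e y)).aff₀
    ∀ ⦃T : SchemeOver (geomResidueField w)⦄ (t : T ⟶ (𝔡 (red₀Of S Kc 𝓜 w h𝓨 e y)).G₀),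
      t ≫ (𝔡 (red₀Of S Kc 𝓜 w h𝓨 e y)).ι₀G ≫
          (qbar : (sch₀Of 𝓜 w I.univ (red₀Of S Kc 𝓜 w h𝓨 e y)).X ⟶ (sch₀Of 𝓜 w (serreTensor I.act E' hE') (red₀Of S Kc 𝓜 w h𝓨 e y'')).X) = 1 ↔
        ∃ s : T ⟶ specOver (geomResidueField w) (Alg (𝔡 (red₀Of S Kc 𝓜 w h𝓨 e y)).G₀ ⧸ (spGeoOf I 𝔡 y L).1),
          s ≫ quotIncl (𝔡 (red₀Of S Kc 𝓜 w h𝓨 e y)).G₀ (spGeoOf I 𝔡 y L).1 = t := by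
  haveI := I.comm
  exact (fun (ψ : (sch₀Of 𝓜 w I.univ (red₀Of S Kc 𝓜 w h𝓨 e y)).X ⟶ (sch₀Of 𝓜 w (serreTensor I.act E' hE') (red₀Of S Kc 𝓜 w h𝓨 e y'')).X) (h : qbar = ψ) =>
      dock_row_of_kerRow I 𝔡 E' hE' y y'' L ψ (s₁ ψ h).1 (s₁ ψ h).2.1 (s₂ ψ h) (s₁ ψ h).2.2.1 (s₁ ψ h).2.2.2
    (s₃ ψ h).1 (s₃ ψ h).2) _ rfl

end DockRow

section DockFold

open scoped MonObj CategoryTheory.Obj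
open Literature.AlgebraicGeometry.GroupSchemes (GroupSchemeKernel.ker)

end DockFold

end QuotLegReduction

end Summit.HodgeConjecture.HodgeConjecture.Cruxes.HLiu418.F0P6aLineSpecialisation

end
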